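import Summits.Ventures.PercRepro.S1ChainCq

/-!
# PercRepro — THE CHAIN WITH ITS FAMILY (p2, gen 23; SUBCLAIM-S1 §6.8 (v))

`exists_chain_set` (S1ChainCq) returns the chain's union and its pairwise disjoint subfamily. The per-pair kill
(S1ChainPairs) wants the chain FAMILY itself, whose union is the set `S`: `exists_chain_family` is the same greedy
chain returning `𝒯′` with `⋃𝒯′ = S` — `|𝒯′| = r` with `≤ s₃ − r` triangles outside, or `|𝒯′| < r` with every
triangle inside (the early stop, nullity from the restriction cap).
Axioms: standard.
-/

open scoped Matroid

namespace PercRepro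

namespace S1

open Set

variable {α : Type}

/-- **THE CHAIN DICHOTOMY WITH THE CHAIN ITSELF**: for `r` with `cq3 (r − 1) < s₃` (and `cq3` monotone below
`r`) there are `S ⊆ E` of nullity `≥ r` and a family `𝒯′` of triangles with `⋃𝒯′ = S` such that EITHER `|𝒯′| = r` and
at most `s₃ − r` triangles lie outside `S` (the greedy chain of `r` triangles), OR `|𝒯′| < r` and every triangle lies
inside `S` (the early stop; the nullity from the restriction cap `cq3`). The per-pair kill
(S1ChainPairs) is applied to `𝒯′` with `u = |S|`. -/
theorem exists_chain_family (M : Matroid α) [M.Finite]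
    (hfree : ∀ e ∈ M.E, ∃ A ⊆ M.E \ {e}, e ∉ M.closure A ∧ e ∉ M.closure ((M.E \ {e}) \ A))
    (r : ℕ) (hcq : TriangleCap.cq3 (r - 1) < (ThmN.triangles M).ncard)
    (hmono : ∀ ν < r, TriangleCap.cq3 ν ≤ TriangleCap.cq3 (r - 1)) :
    ∃ S ⊆ M.E, ∃ 𝒯' : Finset (Set α), (∀ C ∈ 𝒯', M.IsCircuit C ∧ C.ncard = 3) ∧ (⋃ C ∈ 𝒯', C) = S ∧
      S.ncard ≤ 3 * 𝒯'.card ∧ M.eRk S + (r : ℕ∞) ≤ (S.ncard : ℕ∞) ∧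
      ((𝒯'.card = r ∧
          {C : Set α | M.IsCircuit C ∧ C.ncard = 3 ∧ ¬ C ⊆ S}.ncard + r ≤ (ThmN.triangles M).ncard) ∨
        (𝒯'.card + 1 ≤ r ∧ ∀ C, M.IsCircuit C → C.ncard = 3 → C ⊆ S)) := by
  classical
  have hEfin : M.E.Finite := M.ground_finite
  have htfin : (ThmN.triangles M).Finite := hEfin.finite_subsets.subset (fun C hC => hC.1.subset_ground)
  set 𝒯 := htfin.toFinset with h𝒯
  have hmem𝒯 : ∀ C, C ∈ 𝒯 ↔ M.IsCircuit C ∧ C.ncard = 3 := fun C => by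
    rw [h𝒯, Set.Finite.mem_toFinset]; rfl
  have h𝒯card : 𝒯.card = (ThmN.triangles M).ncard := (Set.ncard_eq_toFinset_card _ htfin).symm
  -- the invariant after `j` steps
  set P : ℕ → Prop := fun j => ∃ S ⊆ M.E, M.eRk S + (j : ℕ∞) ≤ (S.ncard : ℕ∞) ∧ S.ncard ≤ 3 * j ∧
    (∃ 𝒯' ⊆ 𝒯, 𝒯'.card = j ∧ (⋃ C ∈ 𝒯', C) = S) with hP
  -- the early stop
  set Q : Prop := ∃ S ⊆ M.E, ∃ j, j < r ∧ S.ncard ≤ 3 * j ∧ (∃ 𝒯' ⊆ 𝒯, 𝒯'.card = j ∧ (⋃ C ∈ 𝒯', C) = S) ∧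
    (∀ C ∈ 𝒯, C ⊆ S) with hQ
  have hchain : ∀ j, j ≤ r → P j ∨ Q := by
    intro j
    induction j with
    | zero =>
      intro _
      left
      refine ⟨∅, Set.empty_subset _, by simp, by simp, ∅, Finset.empty_subset _, rfl, by simp⟩
    | succ j ih =>
      intro hjr
      rcases ih (by omega) with ⟨S, hS, hν, hS3, 𝒯', h𝒯'sub, h𝒯'card, h𝒯'un⟩ | hQ'
      · by_cases hex : ∃ C ∈ 𝒯, ¬ C ⊆ S
        · obtain ⟨C, hC, hCS⟩ := hex
          left
          have hC' := (hmem𝒯 C).1 hC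
          have hCE : C ⊆ M.E := hC'.1.subset_ground
          have hν' := eRk_union_triangle_add_le M hS hC' hCS hν
          have hS3' : (S ∪ C).ncard ≤ 3 * (j + 1) := by
            have := Set.ncard_union_le S C
            rw [hC'.2] at this
            omega
          refine ⟨S ∪ C, Set.union_subset hS hCE, hν', hS3', insert C 𝒯', Finset.insert_subset hC h𝒯'sub, ?_, ?_⟩
          · rw [Finset.card_insert_of_notMem (fun h => hCS (by rw [← h𝒯'un]; exact fun x hx => Set.mem_iUnion₂.2 ⟨C, h, hx⟩)),
              h𝒯'card]
          · rw [Finset.set_biUnion_insert, h𝒯'un, Set.union_comm]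
        · right
          push Not at hex
          exact ⟨S, hS, j, by omega, hS3, ⟨𝒯', h𝒯'sub, h𝒯'card, h𝒯'un⟩, hex⟩
      · right; exact hQ'
  rcases hchain r le_rfl with ⟨S, hS, hν, hS3, 𝒯', h𝒯'sub, h𝒯'card, h𝒯'un⟩ |
    ⟨S, hS, j, hjr, hS3, ⟨𝒯', h𝒯'sub, h𝒯'card, h𝒯'un⟩, hall⟩
  · -- the chain of `r` triangles
    refine ⟨S, hS, 𝒯', fun C hC => (hmem𝒯 C).1 (h𝒯'sub hC), h𝒯'un, by omega, hν, Or.inl ⟨h𝒯'card, ?_⟩⟩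
    have hsub : {C : Set α | M.IsCircuit C ∧ C.ncard = 3 ∧ ¬ C ⊆ S} ⊆ ((𝒯 \ 𝒯' : Finset (Set α)) : Set (Set α)) := by
      intro C hC
      rw [Finset.mem_coe, Finset.mem_sdiff, hmem𝒯]
      exact ⟨⟨hC.1, hC.2.1⟩, fun h => hC.2.2 (by rw [← h𝒯'un]; exact fun x hx => Set.mem_iUnion₂.2 ⟨C, h, hx⟩)⟩
    have h1 := Set.ncard_le_ncard hsub (Finset.finite_toSet _)
    rw [Set.ncard_coe_finset, Finset.card_sdiff_of_subset h𝒯'sub, h𝒯'card, h𝒯card] at h1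
    have h2 : r ≤ (ThmN.triangles M).ncard := by
      rw [← h𝒯card, ← h𝒯'card]; exact Finset.card_le_card h𝒯'sub
    omega
  · -- every triangle inside `S`: the restriction cap gives the nullity
    have hSfin : S.Finite := hEfin.subset hS
    have hrS : M.eRk S ≠ ⊤ := ((M.eRk_le_encard S).trans_lt hSfin.encard_lt_top).ne
    obtain ⟨a, ha⟩ := ENat.ne_top_iff_exists.1 hrS
    have haS : a ≤ S.ncard := by
      have h := M.eRk_le_encard S
      rw [← ha, ← hSfin.cast_ncard_eq] at h
      exact_mod_cast h
    have hν : S.encard = M.eRk S + ((S.ncard - a : ℕ) : ℕ∞) := by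
      rw [← ha, ← hSfin.cast_ncard_eq]
      norm_cast
      omega
    have hcap := ncard_triangles_subset_le_cq3 M hfree hS hν
    have hall' : {C : Set α | M.IsCircuit C ∧ C.ncard = 3 ∧ C ⊆ S} = ThmN.triangles M := by
      ext C
      simp only [Set.mem_setOf_eq]
      constructor
      · rintro ⟨h1, h2, -⟩; exact ⟨h1, h2⟩
      · rintro ⟨h1, h2⟩; exact ⟨h1, h2, hall C ((hmem𝒯 C).2 ⟨h1, h2⟩)⟩
    rw [hall'] at hcap
    have hνr : r ≤ S.ncard - a := by
      by_contra hlt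
      push Not at hlt
      have := hmono (S.ncard - a) hlt
      omega
    refine ⟨S, hS, 𝒯', fun C hC => (hmem𝒯 C).1 (h𝒯'sub hC), h𝒯'un, by omega, ?_,
      Or.inr ⟨by omega, fun C hC h3 => hall C ((hmem𝒯 C).2 ⟨hC, h3⟩)⟩⟩
    rw [← ha]
    have : a + r ≤ S.ncard := by omega
    exact_mod_cast this

end S1

end PercRepro
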